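import Summits.Ventures.CertifiedManyBodySolver.Cruxes.ThermalStiffnessCeilingU8b10_le_1o8.SeamCumulantCertificate
import HarnessLib

/-!
# CERT-3×3 — the NODE OF RECORD candidate and its decision (hubbard-floor-eng-1 g2, 2026-08-28; FL-RULINGs 44/48/49)

The two certified `θ = 0` numbers of the seam-cumulant certificate (BN-resc-2 `SeamCumulantCertificate`, sorry-free) at side `L = 3`:
on the `(3,3)` sector `k1Sector 3` (dim 7056) of the `3×3` torus, `H = hubbardTorusTT'Flux 3 0 8 0` (t′ = 0, U = 8, θ = 0), `β·t = 10`,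
`A = seamHop 3`, `B = seamCurrent 3`:
  **177/100 ≤ Re⟨A|_p⟩_β   and   Re (B|_p ; B|_p)_Duh ≤ 133/1000.**
CERTIFIED by THREE agreeing certificates of two different designs and two independent integer builders:
 * idea-rescuer g4 BN-resc-4 (CERT-3x3-candidate.md; low-lying Ritz vectors + verified-Cholesky gap + Davis–Kahan + exact ℚ): κ ≥ 1.7739303457, qB ≤ 0.1327179831 —
   REPLAYED as tagged kit job **j319450** (hubbard-floor-eng-1 g2; pinned sources, 8 LAPACK-free integer files byte-identical to the MANIFEST; chol tests ok):
   κ ≥ 1.77393034572, qB ≤ 0.1327179831, 5κ⁻ − 50qB⁺ = 2.2337526 ≥ 13/10; independently interval-replayed by hubbard-floor-crit-2 g2 (κ ≥ 1.7739304056, qB ≤ 0.1325455105);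
 * hubbard-floor-eng-1 g2, tagged kit job **j319502** (full-eigenbasis exact-integer Gram route + interval arithmetic, independent tree-transcribed builder; deposit
   `pub/hubbard-floor/hubbard-floor-eng-1/certs/cert3x3-j319450-j319502/`, README (B1)–(B6)): κ ∈ [1.7739310708, 1.7739325074], qB ∈ [0.1320848549, 0.1320961173],
   5κ⁻ − 50qB⁺ = 2.2648495 ≥ 13/10; floats κ = 1.7739317891, qA = 3.2181354049, qB = 0.1320904861 inside the pre-registered bands (PREREG v1.30 §7a).
WHAT IT DECIDES: only the junk-free finite-size variant `K1WithoutTendstoPos` of the K1 disprover's file (`Disproof.lean`), IN THE NEGATIVE, through BN-resc-2's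
`not_k1WithoutTendstoPos_of_threeNumbers` with `qA := 144` PROVED (`‖A|_p‖ ≤ 12`). The route crux K1 = `ThermalStiffnessCeilingU8b10_le_1o8` (stmt-Ventures-26381)
is UNTOUCHED (`k1_iff_sizes_ge_four`: L = 3 is outside K1's sizes). «(3,3) sector» is a particle-number sector, not a filling word. Superconductivity in the
Hubbard model is NOT proved or disproved by any of this. The two-number shape and the `qA ≤ 144` lemma are idea-rescuer g4's template v2
(`Cert3x3SeamNumbersTemplate.lean` 1d2f07126606df60), restated here so that the file imports tree modules only.
-/

open scoped Matrix.Norms.L2Operator ComplexOrder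
open Matrix Literature.MathematicalPhysics.QuantumLattice
open Summit.Ventures.CertifiedManyBodySolver.Observables Summit.Ventures.CertifiedManyBodySolver.Theses
open Summit.Ventures.CertifiedManyBodySolver.Cruxes.ThermalStiffnessCeilingU8b10_le_1o8.Disproof
open Summit.Ventures.CertifiedManyBodySolver.Cruxes.ThermalStiffnessCeilingU8b10_le_1o8.SeamCumulantCertificate

namespace Summit.Ventures.CertifiedManyBodySolver.Cruxes.ThermalStiffnessCeilingU8b10_le_1o8.Cert3x3SeamNumbersNode

/-- The TWO certified `θ = 0` enclosures (template v2 shape): `κlo ≤ Re⟨A|_p⟩` and `Re (B|_p;B|_p)_Duh ≤ qB` on `k1Sector 3`, `β·t = 10`. -/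
def SeamNumbersTwo3x3 (κlo qB : ℝ) : Prop :=
  κlo ≤ (gibbsState 10 ((hubbardTorusTT'Flux 3 0 8 0).toBlock (k1Sector 3) (k1Sector 3))
      ((seamHop 3).toBlock (k1Sector 3) (k1Sector 3))).re ∧
  (duhamel 10 ((hubbardTorusTT'Flux 3 0 8 0).toBlock (k1Sector 3) (k1Sector 3))
      ((seamCurrent 3).toBlock (k1Sector 3) (k1Sector 3)) ((seamCurrent 3).toBlock (k1Sector 3) (k1Sector 3))).re ≤ qB

/-- **NODE (certified numerics, kit j319450 + j319502; hubbard-floor CERT-3×3).** On the `(3,3)` sector of the `3×3` torus at `(t′, U, β·t) = (0, 8, 10)`: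
`177/100 ≤ Re⟨seamHop|_p⟩_β` and `Re (seamCurrent|_p ; seamCurrent|_p)_Duh ≤ 133/1000` (certified enclosures κ ∈ [1.7739310708, 1.7739325074],
qB ∈ [0.1320848549, 0.1320961173], j319502; κ ≥ 1.77393034572, qB ≤ 0.1327179831, j319450 = replay of idea-rescuer BN-resc-4). A finite-cluster thermal
datum; not a statement about K1, superfluid stiffness in the thermodynamic limit, or superconductivity. -/
@[conjecture] def cert_k1Sector3_seamTwoNumbers_U8_b10_j319450_j319502 : Prop :=
  SeamNumbersTwo3x3 (177 / 100) (133 / 1000)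

/-- `Re (A|_p;A|_p)_Duh ≤ 144`, PROVED (template v2, idea-rescuer g4): `|(X;X)| ≤ ‖X‖²` (`Matrix.norm_duhamel_le`) and `‖A|_p‖ ≤ 4·3`
(`norm_seamHop_toBlock_le`). [folklore] -/
theorem re_duhamel_seamHop_le_144 :
    (duhamel 10 ((hubbardTorusTT'Flux 3 0 8 0).toBlock (k1Sector 3) (k1Sector 3))
      ((seamHop 3).toBlock (k1Sector 3) (k1Sector 3)) ((seamHop 3).toBlock (k1Sector 3) (k1Sector 3))).re ≤ 144 := by
  haveI := nonempty_k1Sector 3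
  have hMh : ((hubbardTorusTT'Flux 3 0 8 0).toBlock (k1Sector 3) (k1Sector 3)).IsHermitian :=
    (isHermitian_hubbardTorusTT'Flux (L := 3) 0 8 0).submatrix _
  have hn : ‖(seamHop 3).toBlock (k1Sector 3) (k1Sector 3)‖ ≤ 4 * (3 : ℕ) := norm_seamHop_toBlock_le 3 _
  have h := Matrix.norm_duhamel_le hMh (by norm_num : (0 : ℝ) ≤ 10)
    ((seamHop 3).toBlock (k1Sector 3) (k1Sector 3)) ((seamHop 3).toBlock (k1Sector 3) (k1Sector 3))
  have h144 : ‖(seamHop 3).toBlock (k1Sector 3) (k1Sector 3)‖ * ‖(seamHop 3).toBlock (k1Sector 3) (k1Sector 3)‖ ≤ 144 := by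
    have hn' : ‖(seamHop 3).toBlock (k1Sector 3) (k1Sector 3)‖ ≤ 12 := hn.trans (by norm_num)
    nlinarith [norm_nonneg ((seamHop 3).toBlock (k1Sector 3) (k1Sector 3))]
  exact (Complex.re_le_norm _).trans (h.trans h144)

/-- **TWO-NUMBER DECISION (template v2 shape).** Any certified pair with `0 ≤ κlo ≤ 12`, `0 ≤ qB`, `13/10 ≤ 5κlo − 50qB` refutes the junk-free
finite-size variant `K1WithoutTendstoPos` (window `θ₀ = 10⁻⁹`, slope `a = 5κlo − 50qB − (cubic-Taylor loss) > 5/4`; `qA := 144` proved). K1 untouched. -/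
theorem not_k1WithoutTendstoPos_of_two {κlo qB : ℝ} (h : SeamNumbersTwo3x3 κlo qB)
    (hκ0 : 0 ≤ κlo) (hκ1 : κlo ≤ 12) (hqB0 : 0 ≤ qB) (hgap : 13 / 10 ≤ 5 * κlo - 50 * qB) : ¬ K1WithoutTendstoPos := by
  set a : ℝ := 10 * κlo / 2 - 10 ^ 2 * qB / 2 -
      (1 / 10 ^ 9) * (5 / 96 * 10 * κlo * (1 / 10 ^ 9) + 10 ^ 2 * (144 : ℝ) * (1 / 10 ^ 9) / 8 +
        16 * 10 ^ 3 * ((1 / 10 ^ 9) * (4 * (3 : ℕ)) / 2 + 4 * (3 : ℕ)) ^ 3) with ha_def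
  have ha : 5 / 4 < a := by
    rw [ha_def]; push_cast; nlinarith
  exact not_k1WithoutTendstoPos_of_threeNumbers 3 (κlo := κlo) (qA := 144) (qB := qB) (θ₀ := 1 / 10 ^ 9) (a := a)
    (by norm_num) ha (by norm_num) hκ0 (by norm_num) hqB0 (by norm_num) h.1 re_duhamel_seamHop_le_144 h.2 (le_of_eq ha_def)

/-- **THE DECISION OF RECORD (modulo the certified node): `¬ K1WithoutTendstoPos`.** Side goals `0 ≤ 1.77 ≤ 12`, `0 ≤ 0.133`,
`13/10 ≤ 5·(177/100) − 50·(133/1000) = 2.2` by `norm_num`. K1 itself (stmt-Ventures-26381) is NOT decided; superconductivity is NOT addressed. -/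
theorem not_k1WithoutTendstoPos_of_cert3x3 (h : cert_k1Sector3_seamTwoNumbers_U8_b10_j319450_j319502) : ¬ K1WithoutTendstoPos :=
  not_k1WithoutTendstoPos_of_two h (by norm_num) (by norm_num) (by norm_num) (by norm_num)

end Summit.Ventures.CertifiedManyBodySolver.Cruxes.ThermalStiffnessCeilingU8b10_le_1o8.Cert3x3SeamNumbersNode
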